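/-
Width seat `ym-line-cbag-p1-w3` (prover-ym-line-cbag-p1-w3-g10-0; own items stmt-QuantumFields-22254 / 22893 CLOSED proved).  The TWO-SIDED
six-plane DLR transfer and the node `Theorems.TreeLevelLimitWitness` (`SoloInformedTreeLevel.lean`, `@[conjecture]`) as a theorem.
RECORD-type material; the Yang–Mills mass gap is NOT proved by anything here.
-/
import Summits.QuantumFields.YangMills.Theorems.SixPlaneColdBoxTransferUpper
import Summits.QuantumFields.YangMills.Theorems.SixPlaneColdBoxTransferLower
import Summits.QuantumFields.YangMills.Theorems.SixPlaneColdBoxTorusExcessExplicit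
import Summits.QuantumFields.YangMills.Theorems.SixPlaneColdBoxAssembly
import Summits.QuantumFields.YangMills.Theorems.SoloInformedTreeLevel

/-!
# The two-sided six-plane DLR transfer; the node `TreeLevelLimitWitness` holds

* **`sixPlane_twoSided_transfer`** — for every compact simple `G` and every faithful unitary lattice representation `r` there are exponents
  `θ = 60A ∈ (0, 1/200]` such that for all large `β` and then all large odd tori `2S+1`
  `|β²·⟨F₀ ; F_{⌈β^A⌉e₀}⟩_{torus} − β²·Cov_{box ⌈β^θ⌉}(F_c, F_{c+⌈β^A⌉e₀})| ≤ β^{−9A}`, `F = Σ_{i<j} (N − Re tr r(U_{(x;i,j)}))` the six-plane cost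
  sum (action density): the torus two-point function at polynomial separation equals the cold-box covariance to RELATIVE precision `β^{−A}`
  (the cold-box covariance is `≥ cκ²/256·β^{−8A}`, `boxActionDensityFloor_allGroups` + `curvatureCorrPowerFloor_proof`), uniformly in the
  volume.  Halves: `sixPlaneTransfer_lower` (one-sided DLR transfer of LINE 3, re-run at explicit exponents) and `sixPlaneTransfer_upper`
  (the conditional-mean covariance is small: sup over crude-good data × torus-mean excess); torus-mean excess `torusMean_sub_boxMean_le_rpow`.
* **`treeLevelLimitWitness_holds : TreeLevelLimitWitness`** — the solo seat's two-sided tree-level LIMIT node: with the single displacement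
  `d = (⌈β^A⌉, 0)` and the weight `W = (β²·Cov_box)⁻¹ ≤ β` one has `|β²·W·⟨P₀ ; P_d⟩ − 1| ≤ (256/(cκ²))·β^{−A}` (`k = ⌈1/A⌉`, `m = 1`, `q = 1`,
  `σ = A`).  Hence also (already in the tree) `SmearedFloorWitness`, `LatticeNonFreezing` again.

HONEST LABEL: two-sided tree-level asymptotics of ONE family of truncated correlations at polynomial separation, relative to the cold-box
Gaussian covariance — volume-uniform lowest-order perturbation theory for `⟨tr F² ; tr F²⟩`.  NOT exponential clustering, NOT a continuum
limit, NOT the Yang–Mills mass gap; no summit statement is proved here.  No sorry; no new definition; standard axioms.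
-/

set_option autoImplicit false

noncomputable section

open MeasureTheory ProbabilityTheory Finset Real Filter Topology Metric
open Literature.Probability.LatticeModels (Site)
open Literature.MathematicalPhysics.QuantumLattice Literature.MathematicalPhysics.QuantumFieldTheory
open Summit.QuantumFields.YangMills.Theorems.WeakCouplingRates Summit.QuantumFields.YangMills.Theorems.FreeEnergyLogCoefficient
open Summit.QuantumFields.YangMills.Theorems.ColdBoxAllGroups

namespace Summit.QuantumFields.YangMills.Theorems

namespace SixPlaneColdBox

/-- **The two-sided six-plane DLR transfer.**  For every compact simple `G` and `r : LatticeRep G` there are `θ = 60A ∈ (0, 1/200]` with, for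
all large `β` and then all large odd tori `2S+1`, `|β²·⟨F ; F⟩_{torus, ⌈β^A⌉} − β²·Cov_{box ⌈β^θ⌉}(F_c, F_{c+⌈β^A⌉e₀})| ≤ β^{−9A}`. -/
theorem sixPlane_twoSided_transfer :
    ∀ (G : Type) [Group G] [TopologicalSpace G] [IsTopologicalGroup G] [CompactSpace G],
      IsCompactSimpleLieGroup G →
        letI : MeasurableSpace G := borel G
        haveI : BorelSpace G := ⟨rfl⟩
        ∀ r : LatticeRep G, ∃ A θ : ℝ, 0 < A ∧ 60 * A = θ ∧ θ ≤ 1 / 200 ∧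
          ∃ β₀ : ℝ, ∀ β : ℝ, β₀ ≤ β → ∃ S₀ : ℕ, ∀ S : ℕ, S₀ ≤ S →
            |β ^ 2 * latticeConnectedCorr r.ρ β (2 * S + 1) (actionDensity r.ρ) (actionDensity r.ρ) ⌈β ^ A⌉₊ -
                β ^ 2 * ((∫ U, (∑ q : {q : Fin 4 × Fin 4 // q.1 < q.2}, plaqCostAt r.ρ (boxCentre ⌈β ^ θ⌉₊) q.1.1 q.1.2 U) *
                (∑ q : {q : Fin 4 × Fin 4 // q.1 < q.2}, plaqCostAt r.ρ (boxCentre ⌈β ^ θ⌉₊ + Pi.single 0 (⌈β ^ A⌉₊ : ℤ)) q.1.1 q.1.2 U) ∂(boxState r.ρ β ⌈β ^ θ⌉₊)) -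
              (∫ U, ∑ q : {q : Fin 4 × Fin 4 // q.1 < q.2}, plaqCostAt r.ρ (boxCentre ⌈β ^ θ⌉₊) q.1.1 q.1.2 U ∂(boxState r.ρ β ⌈β ^ θ⌉₊)) *
                (∫ U, ∑ q : {q : Fin 4 × Fin 4 // q.1 < q.2}, plaqCostAt r.ρ (boxCentre ⌈β ^ θ⌉₊ + Pi.single 0 (⌈β ^ A⌉₊ : ℤ)) q.1.1 q.1.2 U ∂(boxState r.ρ β ⌈β ^ θ⌉₊)))| ≤
              β ^ (-(9 * A)) := by
  intro G _ _ _ _ hG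
  letI : MeasurableSpace G := borel G
  haveI : BorelSpace G := ⟨rfl⟩
  intro r
  obtain ⟨θ, hθ, hθ2, hexc⟩ := torusMean_sub_boxMean_le_rpow G hG r
  have hex := hexc θ hθ le_rfl
  have hA : 0 < θ / 60 := by positivity
  have hA60 : 60 * (θ / 60) = θ := by ring
  obtain ⟨βu, hu⟩ := sixPlaneTransfer_upper G hG r hA hA60 hθ2 hex
  obtain ⟨βl, hl⟩ := sixPlaneTransfer_lower G hG r hA hA60 hθ2 hex
  refine ⟨θ / 60, θ, hA, hA60, hθ2, max βu βl, fun β hβ => ?_⟩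
  obtain ⟨Su, hSu⟩ := hu β ((le_max_left _ _).trans hβ)
  obtain ⟨Sl, hSl⟩ := hl β ((le_max_right _ _).trans hβ)
  refine ⟨max Su Sl, fun S hS => abs_le.2 ⟨?_, ?_⟩⟩
  · have h := hSl S ((le_max_right _ _).trans hS)
    linarith
  · have h := hSu S ((le_max_left _ _).trans hS)
    linarith

end SixPlaneColdBox

/-- **The node `TreeLevelLimitWitness` holds** (`SoloInformedTreeLevel.lean`; the solo seat's two-sided tree-level LIMIT, strictly stronger than
`SmearedFloorWitness`): per compact simple `G` and `r`, with `k = ⌈1/A⌉`, `m = 1`, `q = 1`, `σ = A`, the single displacement `(⌈β^A⌉, 0)` and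
the weight `W = (β²·Cov_box(F_c, F_{c+⌈β^A⌉e₀}))⁻¹`: `|β²·W·⟨P₀ ; P_{(⌈β^A⌉,0)}⟩_{β,S} − 1| ≤ (256/(cκ²))·β^{−A}` on all large tori.
From `sixPlane_twoSided_transfer`, the cold-box floor `boxActionDensityFloor_allGroups` and the curvature floor `curvatureCorrPowerFloor_proof`.
NOT the Yang–Mills mass gap. -/
theorem treeLevelLimitWitness_holds : TreeLevelLimitWitness := by
  intro G _ _ _ _ hG
  letI : MeasurableSpace G := borel G
  haveI : BorelSpace G := ⟨rfl⟩
  intro r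
  obtain ⟨A, θ, hA, hA60, hθ2, β₀, htwo⟩ := SixPlaneColdBox.sixPlane_twoSided_transfer G hG r
  have hAθ : A < θ := by linarith
  have hθ1 : θ ≤ 1 / 100 := by linarith
  obtain ⟨c, hc, β₀', hbox⟩ := ColdBoxAllGroups.boxActionDensityFloor_allGroups G hG r A θ hA hAθ hθ1
  obtain ⟨κ, hκ, n₀, hF⟩ := curvatureCorrPowerFloor_proof
  set v₀ : ℝ := c * (κ ^ 2 / 256) with hv₀
  have hv₀0 : 0 < v₀ := by positivity
  have h8A : 8 * A < 1 := by linarith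
  obtain ⟨β₂, hβ₂1, hpow⟩ := exists_const_mul_rpow_le_rpow (1 / v₀) h8A
  refine ⟨⌈1 / A⌉₊, 1, 1, A, 1 / v₀, one_pos, hA, ?_⟩
  have hev : ∀ᶠ β : ℝ in atTop, β₀ ≤ β ∧ β₀' ≤ β ∧ β₂ ≤ β ∧ (n₀ : ℝ) ≤ β ^ A := by
    filter_upwards [eventually_ge_atTop β₀, eventually_ge_atTop β₀', eventually_ge_atTop β₂,
      (tendsto_rpow_atTop hA).eventually_ge_atTop (n₀ : ℝ)] with β h1 h2 h3 h4
    exact ⟨h1, h2, h3, h4⟩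
  obtain ⟨β₁, hβ₁⟩ := Filter.eventually_atTop.1 hev
  refine ⟨β₁, fun β hβ => ?_⟩
  obtain ⟨hb₀, hb₀', hb₂, hn₀⟩ := hβ₁ β hβ
  have hβ1 : 1 ≤ β := hβ₂1.trans hb₂
  have hβ0 : 0 < β := by linarith
  obtain ⟨S₀, hS₀⟩ := htwo β hb₀
  refine ⟨max S₀ ⌈β ^ A⌉₊, fun S hS => ?_⟩
  have hSS : S₀ ≤ S := (le_max_left _ _).trans hS
  -- the cold-box covariance `V` and its floor `v₀ β^{-8A}`
  set V : ℝ := β ^ 2 * ((∫ U, (∑ q : {q : Fin 4 × Fin 4 // q.1 < q.2}, plaqCostAt r.ρ (boxCentre ⌈β ^ θ⌉₊) q.1.1 q.1.2 U) *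
                (∑ q : {q : Fin 4 × Fin 4 // q.1 < q.2}, plaqCostAt r.ρ (boxCentre ⌈β ^ θ⌉₊ + Pi.single 0 (⌈β ^ A⌉₊ : ℤ)) q.1.1 q.1.2 U) ∂(boxState r.ρ β ⌈β ^ θ⌉₊)) -
              (∫ U, ∑ q : {q : Fin 4 × Fin 4 // q.1 < q.2}, plaqCostAt r.ρ (boxCentre ⌈β ^ θ⌉₊) q.1.1 q.1.2 U ∂(boxState r.ρ β ⌈β ^ θ⌉₊)) *
                (∫ U, ∑ q : {q : Fin 4 × Fin 4 // q.1 < q.2}, plaqCostAt r.ρ (boxCentre ⌈β ^ θ⌉₊ + Pi.single 0 (⌈β ^ A⌉₊ : ℤ)) q.1.1 q.1.2 U ∂(boxState r.ρ β ⌈β ^ θ⌉₊))) with hV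
  have hfl := hbox β hb₀'
  have hn₀' : n₀ ≤ ⌈β ^ A⌉₊ := by
    have : (n₀ : ℝ) ≤ ((⌈β ^ A⌉₊ : ℕ) : ℝ) := hn₀.trans (Nat.le_ceil _)
    exact_mod_cast this
  have hC2 := SixPlaneColdBox.curvature_sq_floor_at_ceil (Cn := curvaturePlaquetteCorr (d := 4) (by norm_num) ((⌈β ^ A⌉₊ : ℕ) : ℤ))
    hβ1 hA.le hκ.le (hF ⌈β ^ A⌉₊ hn₀')
  have h8A0 : 0 < β ^ (8 * A) := Real.rpow_pos_of_pos hβ0 _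
  have hVfloor : v₀ / β ^ (8 * A) ≤ V := by
    have h1 : c * (κ ^ 2 / 256 / β ^ (8 * A)) ≤ V := le_trans (mul_le_mul_of_nonneg_left hC2 hc.le) hfl
    have e : c * (κ ^ 2 / 256 / β ^ (8 * A)) = v₀ / β ^ (8 * A) := by rw [hv₀]; ring
    linarith
  have hVpos : 0 < V := lt_of_lt_of_le (by positivity) hVfloor
  have hVinv : V⁻¹ ≤ β ^ (8 * A) / v₀ := by
    rw [inv_le_comm₀ hVpos (by positivity), inv_div]; exact hVfloor
  -- the witness: one displacement, weight `V⁻¹`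
  refine ⟨{(⌈β ^ A⌉₊, 0)}, fun _ => V⁻¹, fun d hd => ?_, ?_, ?_⟩
  · rw [Finset.mem_singleton] at hd
    subst hd
    exact ⟨ColdBoxAllGroups.le_ceil_rpow_pow_ceil_inv hβ1 hA, (le_max_right _ _).trans hS, rfl⟩
  · rw [Finset.sum_singleton, abs_of_pos (inv_pos.2 hVpos), pow_one]
    calc V⁻¹ ≤ β ^ (8 * A) / v₀ := hVinv
      _ = (1 / v₀) * β ^ (8 * A) := by ring
      _ ≤ β ^ (1 : ℝ) := hpow β hb₂
      _ = β := Real.rpow_one β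
  · rw [Finset.sum_singleton]
    have hshift : (fun U : LGConfig 4 G => r.curvature.F (configShift (-(0 : Literature.Probability.LatticeModels.Site 4)) U)) =
        actionDensity r.ρ := by
      funext U
      show actionDensity r.ρ _ = actionDensity r.ρ U
      congr 1
      funext e
      simp
    rw [hshift]
    show |β ^ 2 * (V⁻¹ * latticeConnectedCorr r.ρ β (2 * S + 1) (actionDensity r.ρ) (actionDensity r.ρ) ⌈β ^ A⌉₊) - 1| ≤
      1 / v₀ * β ^ (-A)
    have htwoS := hS₀ S hSS
    have e : β ^ 2 * (V⁻¹ * latticeConnectedCorr r.ρ β (2 * S + 1) (actionDensity r.ρ) (actionDensity r.ρ) ⌈β ^ A⌉₊) - 1 =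
        V⁻¹ * (β ^ 2 * latticeConnectedCorr r.ρ β (2 * S + 1) (actionDensity r.ρ) (actionDensity r.ρ) ⌈β ^ A⌉₊ - V) := by
      field_simp
    rw [e, abs_mul, abs_of_pos (inv_pos.2 hVpos)]
    calc V⁻¹ * |β ^ 2 * latticeConnectedCorr r.ρ β (2 * S + 1) (actionDensity r.ρ) (actionDensity r.ρ) ⌈β ^ A⌉₊ - V|
        ≤ (β ^ (8 * A) / v₀) * β ^ (-(9 * A)) := mul_le_mul hVinv htwoS (abs_nonneg _) (by positivity)
      _ = 1 / v₀ * (β ^ (8 * A) * β ^ (-(9 * A))) := by ring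
      _ = 1 / v₀ * β ^ (-A) := by rw [← Real.rpow_add hβ0]; ring_nf

end Summit.QuantumFields.YangMills.Theorems

end
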